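import Summits.QuantumFields.BalabanUV.T4Continuum.Support.B13StepEnvelopeEnd
import Summits.QuantumFields.BalabanUV.T4Continuum.Support.B13StepOfRecordReadAt

/-!
# NE5 ∕ U3 — the CAUCHY END faces E9 ∕ E9[rec] (`B13StepEnvelopeEnd`) with the ARITHMETIC letters `ρ₀, k₀, B` ELIMINATED
# (leaf-10's `B13StepEndArithmetic` BY NAME — sharp) and, on the carriers of record, the transport READING discharged on read-at
# slot packages (`B13StepOfRecordReadAt`): the most-reduced Cauchy face of record `∃ C₅, NE5 (outA (readAtSlots S ι) E₀ cB) … θ′ C₅`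

Cell `pub-balaban`, unit `b2b-balaban-t4-ne5-formalise-leaf-03` (NE5 formalisation swarm, LEAF PROVER 03, gen 5; follower of this
lineage's `Support/B13StepEnvelopeEnd.lean` (E9 ∕ E9[rec]) in the pattern of leaf-10's `B13StepEndArithmetic.exists_ne5_of_record`
(E1[rec] letters eliminated, p210647) and this lineage's `B13StepOfRecordReadAt.exists_ne5_of_record_readAt` (reading discharged,
p212254)).  Summits-side NEW WORK under the LEAN PLACEMENT RULE; no definition; no owner END-face module edited.  HONEST FRAMING: rung
(B)+1 of the FINITE-VOLUME T⁴ continuum programme — NOT infinite volume, NOT a mass gap, NOT the Clay problem, and **NOT A PROOF OF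
NE5**: implications from DISPLAYED binders (W2-op = `ActOpLineAnalyticOn` at factor level — wall G-ne5p1-1′∕1″ RELOCATED, NOT PRINTED;
the (2.38)-KIND activity norm majorant with per-domain budget ∕ decay split + anchored norm; W1 in row NE2's entry currency; W4; the W3
slice budgets; the quoted levels L05∕L06; room; signs; `0 < θ < 1`, `θ ≤ θ′ ≤ 1`; and TWO strict size inequalities).  HONEST DEPENDENCY
(cell line, verbatim): continuum YM on T⁴ ⇐ BetaPertH ∧ nine spine estimates (0/9 proved); BetaPertH ⇐ (D1) ∧ (D4) ∧ CAP+tail; G-an2-4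
gates asym, D1 and NE2/3/4.

WHAT IS PROVED (kernel; `[folklore]`):
* §1 **`exists_ne5_of_assembly_envelope`** — E9 (`B13StepEnvelopeEnd.ne5_of_assembly_envelope`, W1 in the entry currency) with its
  binders `hρ₀`, `hnear`, `hB`, `hfirst`, `hsmall` over the letters `ρ₀, k₀, B` REPLACED by `0 < θ < 1` and the two strict size
  inequalities `cA(EA₀ + E₀) < 1 − ω`, `ω + G·cA·(1 − ω)∕(1 − ω − cA(EA₀ + E₀)) < θ′` — leaf-10's `reach_elim_iff` ∕
  `reach_binders_exists` ∕ `smallness_of_gain` BY NAME (E9's numerics ARE E1's, so leaf-10's `arithmetic_letters_iff` applies verbatim: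
  nothing lost); `E₁ := 1`.  Conclusion `∃ C₅, NE5 (𝔄.outA (𝔄.bHist E₀ cB)) (𝔄.outB (𝔄.bHist E₀ cB)) W κ θ′ C₅`.
* §2 **`exists_ne5_of_record_envelope_actNormDecay`** — the same on the carriers of record (`G := Φ′∕(1 − 36Φ′)`):
  `∃ C₅, NE5 (outA S E₀ cB) (outB S E₀ cB) W κ θ′ C₅`.
* §3 **`exists_ne5_of_record_envelope_readAt`** — §2 at the slot package READ AT THE TRANSPORTED BACKGROUND `readAtSlots S ι` with
  `hT := transportReads_record_readAt S ι W` (the reading BY CONSTRUCTION): **the most-reduced Cauchy face of record** — NO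
  `TransportReads` binder, NO arithmetic letter, the operator half of W2 ONE factor-level binder `ActOpLineAnalyticOn`, the history half
  STRUCTURE `ActExpLinearOn`, the per-domain budget a THEOREM from the anchored norm.
Nothing is asserted about [II]'s kernels ∕ potentials ∕ terms (the `Slots` stay PARAMETERS).  0 sorry; axioms ⊆ {propext,
Classical.choice, Quot.sound}.
-/

noncomputable section

open scoped BigOperators
open Metric Set

namespace Summit.QuantumFields.BalabanUV.T4Continuum.B13StepEnvelopeEndArithmetic

open Literature.MathematicalPhysics.QuantumFieldTheory.Balaban1983to89
open Literature.MathematicalPhysics.QuantumFieldTheory.Balaban1983to89.T4OutputRate (Carriers Functional DecayBound NE5)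
open Literature.MathematicalPhysics.QuantumFieldTheory.Balaban1983to89.T4InputCauchyRateSpecies (ballClass)
open Summit.QuantumFields.BalabanUV.T4Continuum.B13Carriers (TwoRuns)
open Summit.QuantumFields.BalabanUV.T4Continuum.B13OpDatum (OpDatum)
open Summit.QuantumFields.BalabanUV.T4Continuum.B13OpDatumJunctions (RawBounded WeightedEntrywiseRate)
open Summit.QuantumFields.BalabanUV.T4Continuum.B13StepTermLabels (TermIdx InnerLabel)
open Summit.QuantumFields.BalabanUV.T4Continuum.B13StepTermFamily (ActData ActExpLinearOn)
open Summit.QuantumFields.BalabanUV.T4Continuum.B13StepTermSocket (labelsIndexing touchInc)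
open Summit.QuantumFields.BalabanUV.T4Continuum.B13InnerData (Bnd b13InnerData)
open Summit.QuantumFields.BalabanUV.T4Continuum.B13TermRep (actMajorant)
open Summit.QuantumFields.BalabanUV.T4Continuum.UrsellTreeSum (ind)
open Summit.QuantumFields.BalabanUV.T4Continuum.UrsellTermBudget (actSum)
open Summit.QuantumFields.BalabanUV.T4Continuum.B13Base (selfCtr)
open Summit.QuantumFields.BalabanUV.T4Continuum.B13Represents (Assembly)
open Summit.QuantumFields.BalabanUV.T4Continuum.B13DomainGeometryTR (SCube footprint domainGeometry)
open Summit.QuantumFields.BalabanUV.T4Continuum.B13StepOfRecord (assembly step outA outB)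
open Summit.QuantumFields.BalabanUV.T4Continuum.B13StepEndArithmetic (reach_elim_iff smallness_of_gain)
open Summit.QuantumFields.BalabanUV.T4Continuum.OutputRateArithmetic (reach_binders_exists)
open Summit.QuantumFields.BalabanUV.T4Continuum.B13StepOfRecordReadAt (readAtSlots transportReads_record_readAt)
open Summit.QuantumFields.BalabanUV.T4Continuum.B13TermOpEnvelope (ActOpLineAnalyticOn)
open Summit.QuantumFields.BalabanUV.T4Continuum.B13StepEnvelopeEnd (ne5_of_assembly_envelope ne5_of_record_envelope_actNormDecay)

/-! ## §1 E9 on the assembled model with the letters eliminated -/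

section Assembled

variable {C : Carriers} {E IOp Hist ι P J Ω : Type*} [NormedAddCommGroup Hist] [NormedSpace ℂ Hist] [MeasurableSpace Ω]
  (𝔄 : Assembly C E IOp Hist ι P J)

/-- [folklore] **THE CAUCHY END FACE ON THE ASSEMBLED MODEL, ARITHMETIC LETTERS ELIMINATED** — `B13StepEnvelopeEnd.ne5_of_assembly_envelope`
with its binders `hρ₀`, `hnear`, `hB`, `hfirst`, `hsmall` over the letters `ρ₀, k₀, B` REPLACED by `0 < θ < 1` and the two strict size
inequalities `cA(EA₀ + E₀) < 1 − ω`, `ω + G·cA·(1 − ω)∕(1 − ω − cA(EA₀ + E₀)) < θ′` (leaf-10's `reach_elim_iff` ∕ `reach_binders_exists`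
∕ `smallness_of_gain`: nothing lost), `E₁ := 1`; every analytic binder BY NAME and unchanged (per-activity norm majorant + per-domain
budget on the ball class, `ActOpLineAnalyticOn`, `ActExpLinearOn`, W1 entry data, W4, W3 ×2, L05∕L06, room).  NOT a proof of NE5. -/
theorem exists_ne5_of_assembly_envelope {W : Set (ℕ → ℝ)} {ROp RHist : ℕ → ℝ} {A : ℕ → (ℕ → ℝ) → C.BgB → P → J → ℝ}
    {Dt : ActData P J (OpDatum E) Hist Ω} {κ G EA₀ E₀ cA cB c₁ r₀ δ' θ θ' : ℝ}
    (hT : 𝔄.TransportReads W)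
    (hbB : 𝔄.SliceBudgetB W κ cB) (hbA : 𝔄.D.SliceBudget (𝔄.step (𝔄.bHist E₀ cB)) W κ cA)
    (hdA : DecayBound (𝔄.outA (𝔄.bHist E₀ cB)) W EA₀ κ) (hdB : DecayBound (𝔄.outB (𝔄.bHist E₀ cB)) W E₀ κ)
    (hRA : RawBounded 𝔄.F 𝔄.rawAt W) (hRB : RawBounded 𝔄.F 𝔄.rawB W)
    (hwer : WeightedEntrywiseRate 𝔄.F 𝔄.rawAt 𝔄.rawB W c₁ fun k => θ ^ k) (hfl : ∀ k, r₀ ≤ 𝔄.rOp k)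
    (hins : (𝔄.step (𝔄.bHist E₀ cB)).InsertionRate W κ E₀ δ' θ)
    (hOp : ∀ k, 𝔄.rOp k ≤ ROp k) (hHist : ∀ k, 𝔄.bHist E₀ cB k + 𝔄.rHist k ≤ RHist k)
    (hA : ∀ k, ∀ g ∈ W, ∀ (U : C.BgB) (q : OpDatum E × Hist), q ∈ ballClass (selfCtr 𝔄.raw 𝔄.histRef) ROp RHist k g U →
      ∀ X : C.Dom, C.scale X = k → ∀ i, 𝔄.𝒯.Rel k i X → ∀ m,
        ‖𝔄.act (𝔄.𝒯.poly i m) (𝔄.𝒯.lab i m) q.1 q.2‖ ≤ A k g U (𝔄.𝒯.poly i m) (𝔄.𝒯.lab i m))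
    (hbud : ∀ k, ∀ g ∈ W, ∀ (U : C.BgB) (X : C.Dom), C.scale X = k →
      Summable (actMajorant 𝔄.𝒯 𝔄.inc (A k g U) k X) ∧
        ∑' i, actMajorant 𝔄.𝒯 𝔄.inc (A k g U) k X i ≤ G * Real.exp (-(κ * C.d X)))
    (hact : ActOpLineAnalyticOn 𝔄.𝒯 𝔄.act (ballClass (selfCtr 𝔄.raw 𝔄.histRef) ROp RHist) W)
    (hexp : ActExpLinearOn 𝔄.𝒯 𝔄.act Dt (ballClass (selfCtr 𝔄.raw 𝔄.histRef) ROp RHist) W)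
    (hE₀ : 0 ≤ E₀) (hG : 0 ≤ G) (hcA : 0 ≤ cA) (hcB : 0 ≤ cB) (hc₁ : 0 ≤ c₁) (hr₀ : 0 < r₀) (hδ' : 0 ≤ δ')
    (hθ0 : 0 < θ) (hθ1 : θ < 1) (hθθ' : θ ≤ θ') (hθ'1 : θ' ≤ 1) (hω : 0 < 𝔄.D.ω) (hω1 : 𝔄.D.ω < 1)
    (hh : cA * (EA₀ + E₀) < 1 - 𝔄.D.ω)
    (hsmall : 𝔄.D.ω + G * cA * (1 - 𝔄.D.ω) / (1 - 𝔄.D.ω - cA * (EA₀ + E₀)) < θ') :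
    ∃ C₅, NE5 (𝔄.outA (𝔄.bHist E₀ cB)) (𝔄.outB (𝔄.bHist E₀ cB)) W κ θ' C₅ := by
  obtain ⟨ρ₀, hreach, hρ₀, hs⟩ := (reach_elim_iff (mul_nonneg hG hcA) hω1).mpr ⟨hh, hsmall⟩
  obtain ⟨k₀, B, hB, hnear, hfirst⟩ :=
    reach_binders_exists (D := c₁ / r₀ + δ') (add_nonneg (div_nonneg hc₁ hr₀.le) hδ') hθ0 hθ1 hreach
  exact ⟨_, ne5_of_assembly_envelope 𝔄 hT hbB hbA hdA hdB hRA hRB hwer hfl hins hOp hHist hA hbud hact hexp hE₀ one_pos hG hcA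
    hcB hc₁ hr₀ hδ' hθ0.le hθθ' hθ'1 hω hω1 hρ₀ hnear hB hfirst (smallness_of_gain hs)⟩

end Assembled

/-! ## §2 E9[rec] on the carriers of record with the letters eliminated -/

section Record

variable {G : Type} [GaugeGroup G] {R : TwoRuns G} {E IOp Hist Ω : Type*} [NormedAddCommGroup Hist] [NormedSpace ℂ Hist]
  [MeasurableSpace Ω] (S : B13StepOfRecord.Slots R E IOp Hist) (E₀ cB : ℝ)

/-- [folklore] **PER PAIR OF RUNS**: `B13StepEnvelopeEnd.ne5_of_record_envelope_actNormDecay` (per-domain budget from the decay split and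
the anchored norm `Φ′`, `G := Φ′∕(1 − 36Φ′)`) with the arithmetic letters eliminated — `∃ C₅, NE5 (outA S E₀ cB) (outB S E₀ cB) W κ θ′ C₅`
at the prescribed rate from the displayed analytic binders, `0 < θ < 1`, `θ ≤ θ′ ≤ 1` and the two strict size inequalities
`cA(EA₀ + E₀) < 1 − ω`, `ω + (Φ′∕(1 − 36Φ′))·cA·(1 − ω)∕(1 − ω − cA(EA₀ + E₀)) < θ′`. -/
theorem exists_ne5_of_record_envelope_actNormDecay {W : Set (ℕ → ℝ)} {ROp RHist : ℕ → ℝ}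
    {A A' : ℕ → (ℕ → ℝ) → R.carriers.BgB → R.carriers.Dom → InnerLabel R.carriers.Dom (Bnd R) → ℝ}
    {Dt : ActData R.carriers.Dom (InnerLabel R.carriers.Dom (Bnd R)) (OpDatum E) Hist Ω}
    {κ Φ' EA₀ cA c₁ r₀ δ' θ θ' : ℝ}
    (hT : (assembly S).TransportReads W)
    (hbB : (assembly S).SliceBudgetB W κ cB) (hbA : S.D.SliceBudget (step S E₀ cB) W κ cA)
    (hdA : DecayBound (outA S E₀ cB) W EA₀ κ) (hdB : DecayBound (outB S E₀ cB) W E₀ κ)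
    (hRA : RawBounded S.F (assembly S).rawAt W) (hRB : RawBounded S.F S.rawB W)
    (hwer : WeightedEntrywiseRate S.F (assembly S).rawAt S.rawB W c₁ fun k => θ ^ k) (hfl : ∀ k, r₀ ≤ S.rOp k)
    (hins : (step S E₀ cB).InsertionRate W κ E₀ δ' θ)
    (hOp : ∀ k, S.rOp k ≤ ROp k) (hHist : ∀ k, (assembly S).bHist E₀ cB k + S.rHist k ≤ RHist k)
    (hA : ∀ k, ∀ g ∈ W, ∀ (U : R.carriers.BgB) (q : OpDatum E × Hist),
      q ∈ ballClass (selfCtr (assembly S).raw (assembly S).histRef) ROp RHist k g U → ∀ X : R.carriers.Dom, R.carriers.scale X = k →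
        ∀ i : TermIdx R.carriers.Dom (Bnd R), (labelsIndexing (domainGeometry R) (b13InnerData R)).Rel k i X → ∀ m,
          ‖S.act ((labelsIndexing (domainGeometry R) (b13InnerData R)).poly i m)
              ((labelsIndexing (domainGeometry R) (b13InnerData R)).lab i m) q.1 q.2‖ ≤
            A k g U ((labelsIndexing (domainGeometry R) (b13InnerData R)).poly i m)
              ((labelsIndexing (domainGeometry R) (b13InnerData R)).lab i m))
    (hA0 : ∀ k g U Z ℓ, 0 ≤ A k g U Z ℓ) (hA0' : ∀ k g U Z ℓ, 0 ≤ A' k g U Z ℓ) (hκ : 0 ≤ κ)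
    (hdec : ∀ k g U Z ℓ, A k g U Z ℓ ≤ A' k g U Z ℓ * Real.exp (-(κ * (R.carriers.d Z + 5))))
    (hΦ0 : 0 ≤ Φ') (hΦsmall : 36 * Φ' < 1)
    (hΦ : ∀ k, ∀ g ∈ W, ∀ (U : R.carriers.BgB) (q : SCube R),
      ∑ Z ∈ R.domAt k, ind (q ∈ footprint Z) * actSum (b13InnerData R) (A' k g U) k Z * Real.exp ((footprint Z).card) ≤ Φ')
    (hact : ActOpLineAnalyticOn (labelsIndexing (domainGeometry R) (b13InnerData R)) S.act
      (ballClass (selfCtr (assembly S).raw (assembly S).histRef) ROp RHist) W)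
    (hexp : ActExpLinearOn (labelsIndexing (domainGeometry R) (b13InnerData R)) S.act Dt
      (ballClass (selfCtr (assembly S).raw (assembly S).histRef) ROp RHist) W)
    (hE₀ : 0 ≤ E₀) (hcA : 0 ≤ cA) (hcB : 0 ≤ cB) (hc₁ : 0 ≤ c₁) (hr₀ : 0 < r₀) (hδ' : 0 ≤ δ')
    (hθ0 : 0 < θ) (hθ1 : θ < 1) (hθθ' : θ ≤ θ') (hθ'1 : θ' ≤ 1) (hω : 0 < S.D.ω) (hω1 : S.D.ω < 1)
    (hh : cA * (EA₀ + E₀) < 1 - S.D.ω)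
    (hsmall : S.D.ω + Φ' / (1 - 36 * Φ') * cA * (1 - S.D.ω) / (1 - S.D.ω - cA * (EA₀ + E₀)) < θ') :
    ∃ C₅, NE5 (outA S E₀ cB) (outB S E₀ cB) W κ θ' C₅ := by
  have hG : 0 ≤ Φ' / (1 - 36 * Φ') := div_nonneg hΦ0 (by linarith)
  obtain ⟨ρ₀, hreach, hρ₀, hs⟩ := (reach_elim_iff (mul_nonneg hG hcA) hω1).mpr ⟨hh, hsmall⟩
  obtain ⟨k₀, B, hB, hnear, hfirst⟩ :=
    reach_binders_exists (D := c₁ / r₀ + δ') (add_nonneg (div_nonneg hc₁ hr₀.le) hδ') hθ0 hθ1 hreach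
  exact ⟨_, ne5_of_record_envelope_actNormDecay S E₀ cB hT hbB hbA hdA hdB hRA hRB hwer hfl hins hOp hHist hA hA0 hA0' hκ hdec hΦ0
    hΦsmall hΦ hact hexp hE₀ one_pos hcA hcB hc₁ hr₀ hδ' hθ0.le hθθ' hθ'1 hω hω1 hρ₀ hnear hB hfirst (smallness_of_gain hs)⟩

/-! ## §3 The most-reduced Cauchy face of record: read-at slot packages, reading discharged, letters eliminated -/

/-- [folklore] **THE MOST-REDUCED CAUCHY FACE OF RECORD.**  §2 for the slot package READ AT THE TRANSPORTED BACKGROUND `readAtSlots S ι`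
(this lineage's p212254: the transport reading BY CONSTRUCTION, `transportReads_record_readAt`) — `∃ C₅, NE5 (outA (readAtSlots S ι) E₀ cB)
(outB (readAtSlots S ι) E₀ cB) W κ θ′ C₅` from displayed binders NONE of which is a reading, an arithmetic letter, an output-level ∕
term-level W2 statement, or a geometric side condition: W3 ×2, L05∕L06, W1 entry data + floor, W4, room ×2, the (2.38)-KIND activity NORM
majorant `A` with its decay split `A ≤ A′e^{−κ(d+5)}` and the anchored norm `Φ′` of `A′` (`36Φ′ < 1`), **`ActOpLineAnalyticOn` (W2-op at
FACTOR level)**, `ActExpLinearOn` (W2-hist STRUCTURE), signs, `0 < θ < 1`, `θ ≤ θ′ ≤ 1`, `0 < ω < 1`, and the two strict size inequalities. -/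
theorem exists_ne5_of_record_envelope_readAt (ι : (ℕ → ℝ) → R.carriers.BgA → ℕ → IOp) {W : Set (ℕ → ℝ)} {ROp RHist : ℕ → ℝ}
    {A A' : ℕ → (ℕ → ℝ) → R.carriers.BgB → R.carriers.Dom → InnerLabel R.carriers.Dom (Bnd R) → ℝ}
    {Dt : ActData R.carriers.Dom (InnerLabel R.carriers.Dom (Bnd R)) (OpDatum E) Hist Ω}
    {κ Φ' EA₀ cA c₁ r₀ δ' θ θ' : ℝ}
    (hbB : (assembly (readAtSlots S ι)).SliceBudgetB W κ cB)
    (hbA : (readAtSlots S ι).D.SliceBudget (step (readAtSlots S ι) E₀ cB) W κ cA)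
    (hdA : DecayBound (outA (readAtSlots S ι) E₀ cB) W EA₀ κ) (hdB : DecayBound (outB (readAtSlots S ι) E₀ cB) W E₀ κ)
    (hRA : RawBounded S.F (assembly (readAtSlots S ι)).rawAt W) (hRB : RawBounded S.F S.rawB W)
    (hwer : WeightedEntrywiseRate S.F (assembly (readAtSlots S ι)).rawAt S.rawB W c₁ fun k => θ ^ k) (hfl : ∀ k, r₀ ≤ S.rOp k)
    (hins : (step (readAtSlots S ι) E₀ cB).InsertionRate W κ E₀ δ' θ)
    (hOp : ∀ k, S.rOp k ≤ ROp k) (hHist : ∀ k, (assembly S).bHist E₀ cB k + S.rHist k ≤ RHist k)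
    (hA : ∀ k, ∀ g ∈ W, ∀ (U : R.carriers.BgB) (q : OpDatum E × Hist),
      q ∈ ballClass (selfCtr (assembly (readAtSlots S ι)).raw (assembly (readAtSlots S ι)).histRef) ROp RHist k g U →
        ∀ X : R.carriers.Dom, R.carriers.scale X = k →
        ∀ i : TermIdx R.carriers.Dom (Bnd R), (labelsIndexing (domainGeometry R) (b13InnerData R)).Rel k i X → ∀ m,
          ‖S.act ((labelsIndexing (domainGeometry R) (b13InnerData R)).poly i m)
              ((labelsIndexing (domainGeometry R) (b13InnerData R)).lab i m) q.1 q.2‖ ≤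
            A k g U ((labelsIndexing (domainGeometry R) (b13InnerData R)).poly i m)
              ((labelsIndexing (domainGeometry R) (b13InnerData R)).lab i m))
    (hA0 : ∀ k g U Z ℓ, 0 ≤ A k g U Z ℓ) (hA0' : ∀ k g U Z ℓ, 0 ≤ A' k g U Z ℓ) (hκ : 0 ≤ κ)
    (hdec : ∀ k g U Z ℓ, A k g U Z ℓ ≤ A' k g U Z ℓ * Real.exp (-(κ * (R.carriers.d Z + 5))))
    (hΦ0 : 0 ≤ Φ') (hΦsmall : 36 * Φ' < 1)
    (hΦ : ∀ k, ∀ g ∈ W, ∀ (U : R.carriers.BgB) (q : SCube R),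
      ∑ Z ∈ R.domAt k, ind (q ∈ footprint Z) * actSum (b13InnerData R) (A' k g U) k Z * Real.exp ((footprint Z).card) ≤ Φ')
    (hact : ActOpLineAnalyticOn (labelsIndexing (domainGeometry R) (b13InnerData R)) S.act
      (ballClass (selfCtr (assembly (readAtSlots S ι)).raw (assembly (readAtSlots S ι)).histRef) ROp RHist) W)
    (hexp : ActExpLinearOn (labelsIndexing (domainGeometry R) (b13InnerData R)) S.act Dt
      (ballClass (selfCtr (assembly (readAtSlots S ι)).raw (assembly (readAtSlots S ι)).histRef) ROp RHist) W)
    (hE₀ : 0 ≤ E₀) (hcA : 0 ≤ cA) (hcB : 0 ≤ cB) (hc₁ : 0 ≤ c₁) (hr₀ : 0 < r₀) (hδ' : 0 ≤ δ')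
    (hθ0 : 0 < θ) (hθ1 : θ < 1) (hθθ' : θ ≤ θ') (hθ'1 : θ' ≤ 1) (hω : 0 < S.D.ω) (hω1 : S.D.ω < 1)
    (hh : cA * (EA₀ + E₀) < 1 - S.D.ω)
    (hsmall : S.D.ω + Φ' / (1 - 36 * Φ') * cA * (1 - S.D.ω) / (1 - S.D.ω - cA * (EA₀ + E₀)) < θ') :
    ∃ C₅, NE5 (outA (readAtSlots S ι) E₀ cB) (outB (readAtSlots S ι) E₀ cB) W κ θ' C₅ :=
  exists_ne5_of_record_envelope_actNormDecay (readAtSlots S ι) E₀ cB (transportReads_record_readAt S ι W) hbB hbA hdA hdB hRA hRB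
    hwer hfl hins hOp hHist hA hA0 hA0' hκ hdec hΦ0 hΦsmall hΦ hact hexp hE₀ hcA hcB hc₁ hr₀ hδ' hθ0 hθ1 hθθ' hθ'1 hω hω1 hh hsmall

end Record

end Summit.QuantumFields.BalabanUV.T4Continuum.B13StepEnvelopeEndArithmetic

end
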